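import Mathlib
import HarnessLib
import Summits.HubbardSuperconductivity.HubbardSuperconductivity.Theorems.WeakCouplingBCSKlLindhardEnclosureTipCore
import Summits.HubbardSuperconductivity.HubbardSuperconductivity.Theorems.WeakCouplingBCSKlLindhardEnclosureTipMeanValue

/-!
# KL-MARGIN-SCAN reader (22) «kernel-lindhard-enclosure» — TIP RULE, the box bound (measure-theoretic core; cell gate-hubbard-kl, seat p4 g25)

Third generic file of the TIP RULE after `…TipCore` (one-variable integrals) and `…TipMeanValue` (slice data, cross-slice lower bound).  For a
measurable `F ≥ 0` on a closed box `[x₀,x₁] × [y₀,y₁]` with `F ≤ 1/(|e₁| + |e₂|)`, where along every slice `y ↦ e₁(x,y)` is monotone with speed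
`≥ v > 0`, `y ↦ e₂(x,y)` is `m`-Lipschitz, `|e₁| ≤ U₁`, and `|e₁| + |e₂| ≥ κ|x − x†|` (`κ > 0`; in the kernel `κ = J₀/(2L)` from
`sum_abs_ge_of_isMinOn`), one has (Tonelli on `∫⁻`, the slice bound `integral_inv_linear_abs_le`, the outer bound `integral_log_one_add_div_abs_le`):

* **`tip_box_bound`** — `F` is integrable on the box and `∫_box F ≤ (2(1 + m/v)/v)·h_x·(log(1 + 2U₁/(κ h_x)) + 1)`, `h_x = x₁ − x₀`
  — the shape of the kernel's `Params.tipVariant` (`2^31(v+m)10⁴dz(logUp Z₁ + D)/(v²U)` in units `2^-30`, `Z₁/D ≥ 4U₁L/(J₀ h)`).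

`tip_box_bound_swap` — the same with the roles of `x` and `y` exchanged (slices in `x`).
Plus the box-restricted slice lemmas `exists_abs_ge_add_mul_on_of_ge/_le`, `abs_sub_le_mul_abs_on`.  Honest framing: calculus/measure lemmas only; nothing here
asserts `CeilTipSoundOrd`, a χ₀ enclosure, a margin, `K₃`, `U₀`, the window or superconductivity.
References: idea-4 r11 Core §3b/§5 (tree: `…LindhardEnclosureKernel`, `…LindhardEnclosureGate`).
-/

noncomputable section

set_option linter.dupNamespace false

namespace Summit.HubbardSuperconductivity.HubbardSuperconductivity.Theorems.KlLindhardEnclosure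

open Real Set MeasureTheory intervalIntegral
open scoped ENNReal

/-! ## §1 Slice data on a closed interval -/

/-- Growth on `[y₀, y₁]` from a derivative floor there: `f′ ≥ v` on `[y₀,y₁]` ⇒ `v(y − x) ≤ f y − f x` for `y₀ ≤ x ≤ y ≤ y₁`. [folklore] -/
theorem mul_sub_le_sub_on {f f' : ℝ → ℝ} (hf : ∀ y, HasDerivAt f (f' y) y) {v y₀ y₁ : ℝ} (hv : ∀ y ∈ Icc y₀ y₁, v ≤ f' y)
    {x y : ℝ} (hx : x ∈ Icc y₀ y₁) (hy : y ∈ Icc y₀ y₁) (hxy : x ≤ y) : v * (y - x) ≤ f y - f x := by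
  have hcont : ContinuousOn f (Icc y₀ y₁) := fun z _ => (hf z).continuousAt.continuousWithinAt
  have hdiff : DifferentiableOn ℝ f (interior (Icc y₀ y₁)) := fun z _ => (hf z).differentiableAt.differentiableWithinAt
  have hge : ∀ z ∈ interior (Icc y₀ y₁), v ≤ deriv f z := fun z hz => by
    rw [(hf z).deriv]; rw [interior_Icc] at hz; exact hv z (Ioo_subset_Icc_self hz)
  exact (convex_Icc y₀ y₁).mul_sub_le_image_sub_of_le_deriv hcont hdiff hge x hx y hy hxy

/-- **Slice datum on `[y₀, y₁]`**: `f′ ≥ v > 0` there ⇒ `∃ y⋆ ∈ [y₀,y₁], ∀ y ∈ [y₀,y₁], |f y⋆| + v|y − y⋆| ≤ |f y|`. [folklore] -/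
theorem exists_abs_ge_add_mul_on_of_ge {f f' : ℝ → ℝ} (hf : ∀ y, HasDerivAt f (f' y) y) {v y₀ y₁ : ℝ} (hv : 0 < v)
    (hfv : ∀ y ∈ Icc y₀ y₁, v ≤ f' y) (h01 : y₀ ≤ y₁) :
    ∃ ys ∈ Icc y₀ y₁, ∀ y ∈ Icc y₀ y₁, |f ys| + v * |y - ys| ≤ |f y| := by
  have grow : ∀ x ∈ Icc y₀ y₁, ∀ y ∈ Icc y₀ y₁, x ≤ y → v * (y - x) ≤ f y - f x :=
    fun x hx y hy hxy => mul_sub_le_sub_on hf hfv hx hy hxy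
  have hy₀ : y₀ ∈ Icc y₀ y₁ := left_mem_Icc.2 h01
  have hy₁ : y₁ ∈ Icc y₀ y₁ := right_mem_Icc.2 h01
  by_cases h0 : 0 ≤ f y₀
  · refine ⟨y₀, hy₀, fun y hy => ?_⟩
    have hg := grow y₀ hy₀ y hy hy.1
    have hfy : 0 ≤ f y := by nlinarith [hy.1]
    rw [abs_of_nonneg h0, abs_of_nonneg hfy, abs_of_nonneg (sub_nonneg.2 hy.1)]
    linarith
  by_cases h1 : f y₁ ≤ 0
  · refine ⟨y₁, hy₁, fun y hy => ?_⟩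
    have hg := grow y hy y₁ hy₁ hy.2
    have hfy : f y ≤ 0 := by nlinarith [hy.2]
    rw [abs_of_nonpos h1, abs_of_nonpos hfy, abs_of_nonpos (sub_nonpos.2 hy.2)]
    linarith
  push Not at h0 h1
  have hcont : ContinuousOn f (Icc y₀ y₁) := fun z _ => (hf z).continuousAt.continuousWithinAt
  obtain ⟨ys, hys, hfs⟩ : ∃ ys ∈ Icc y₀ y₁, f ys = 0 := intermediate_value_Icc h01 hcont ⟨h0.le, h1.le⟩
  refine ⟨ys, hys, fun y hy => ?_⟩
  rw [hfs, abs_zero, zero_add]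
  rcases le_total ys y with hle | hle
  · have hg := grow ys hys y hy hle
    rw [hfs, sub_zero] at hg
    rw [abs_of_nonneg (sub_nonneg.2 hle), abs_of_nonneg (by nlinarith)]
    exact hg
  · have hg := grow y hy ys hys hle
    rw [hfs, zero_sub] at hg
    rw [abs_of_nonpos (sub_nonpos.2 hle), abs_of_nonpos (by nlinarith)]
    linarith

/-- The same for `f′ ≤ −v` on `[y₀, y₁]`. [folklore] -/
theorem exists_abs_ge_add_mul_on_of_le {f f' : ℝ → ℝ} (hf : ∀ y, HasDerivAt f (f' y) y) {v y₀ y₁ : ℝ} (hv : 0 < v)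
    (hfv : ∀ y ∈ Icc y₀ y₁, f' y ≤ -v) (h01 : y₀ ≤ y₁) :
    ∃ ys ∈ Icc y₀ y₁, ∀ y ∈ Icc y₀ y₁, |f ys| + v * |y - ys| ≤ |f y| := by
  have hneg : ∀ y, HasDerivAt (fun t => -f t) (-f' y) y := fun y => (hf y).neg
  obtain ⟨ys, hys, h⟩ := exists_abs_ge_add_mul_on_of_ge hneg hv (fun y hy => by linarith [hfv y hy]) h01
  exact ⟨ys, hys, fun y hy => by simpa [abs_neg] using h y hy⟩

/-- Lipschitz on `[y₀, y₁]`: `|g′| ≤ m` there ⇒ `|g y − g x| ≤ m|y − x|` for `x, y ∈ [y₀,y₁]`. [folklore] -/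
theorem abs_sub_le_mul_abs_on {g g' : ℝ → ℝ} (hg : ∀ y, HasDerivAt g (g' y) y) {m y₀ y₁ : ℝ} (hm : ∀ y ∈ Icc y₀ y₁, |g' y| ≤ m)
    {x y : ℝ} (hx : x ∈ Icc y₀ y₁) (hy : y ∈ Icc y₀ y₁) : |g y - g x| ≤ m * |y - x| := by
  have hcont : ContinuousOn g (Icc y₀ y₁) := fun z _ => (hg z).continuousAt.continuousWithinAt
  have hdiff : DifferentiableOn ℝ g (interior (Icc y₀ y₁)) := fun z _ => (hg z).differentiableAt.differentiableWithinAt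
  have hle : ∀ z ∈ interior (Icc y₀ y₁), deriv g z ≤ m := fun z hz => by
    rw [(hg z).deriv]; rw [interior_Icc] at hz; exact (abs_le.1 (hm z (Ioo_subset_Icc_self hz))).2
  have hge : ∀ z ∈ interior (Icc y₀ y₁), -m ≤ deriv g z := fun z hz => by
    rw [(hg z).deriv]; rw [interior_Icc] at hz; exact (abs_le.1 (hm z (Ioo_subset_Icc_self hz))).1
  rcases le_total x y with hxy | hxy
  · have h1 := (convex_Icc y₀ y₁).image_sub_le_mul_sub_of_deriv_le hcont hdiff hle x hx y hy hxy
    have h2 := (convex_Icc y₀ y₁).mul_sub_le_image_sub_of_le_deriv hcont hdiff hge x hx y hy hxy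
    rw [abs_of_nonneg (sub_nonneg.2 hxy), abs_le]
    exact ⟨by linarith, h1⟩
  · have h1 := (convex_Icc y₀ y₁).image_sub_le_mul_sub_of_deriv_le hcont hdiff hle y hy x hx hxy
    have h2 := (convex_Icc y₀ y₁).mul_sub_le_image_sub_of_le_deriv hcont hdiff hge y hy x hx hxy
    rw [abs_of_nonpos (sub_nonpos.2 hxy), abs_le]
    exact ⟨by linarith, by linarith⟩

/-! ## §2 The box bound -/

/-- The slice majorant `(1 + m/v)/(v|y − y⋆| + C)` integrates to at most `(1 + m/v)(2/v)·log(1 + v h/(2C))` over `[y₀, y₀ + h]`. [folklore] -/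
theorem integral_slice_majorant_le {v m C y₀ h : ℝ} (hv : 0 < v) (hm : 0 ≤ m) (hC : 0 < C) (hh : 0 ≤ h) (ys : ℝ) :
    ∫ y in y₀..(y₀ + h), (1 + m / v) / (v * |y - ys| + C) ≤ (1 + m / v) * (2 / v * Real.log (1 + v * h / (2 * C))) := by
  have h1 : ∫ y in y₀..(y₀ + h), (1 + m / v) / (v * |y - ys| + C) = (1 + m / v) * ∫ y in y₀..(y₀ + h), (v * |y - ys| + C)⁻¹ := by
    rw [← intervalIntegral.integral_const_mul]
    refine intervalIntegral.integral_congr fun y _ => ?_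
    simp [div_eq_mul_inv]
  rw [h1]
  exact mul_le_mul_of_nonneg_left (integral_inv_linear_abs_le hv hC hh ys) (by positivity)

/-- Monotonicity of the slice bound in the cross-slice datum: `C ≥ κ d > 0` ⇒ `log(1 + v h/(2C)) ≤ log(d + A) − log d`, `A = v h/(2κ)`. [folklore] -/
theorem log_slice_le_of_ge {v h C κ d : ℝ} (hv : 0 ≤ v) (hh : 0 ≤ h) (hκ : 0 < κ) (hd : 0 < d) (hC : κ * d ≤ C) :
    Real.log (1 + v * h / (2 * C)) ≤ Real.log (d + v * h / (2 * κ)) - Real.log d := by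
  have hC0 : 0 < C := lt_of_lt_of_le (mul_pos hκ hd) hC
  rw [← Real.log_div (by positivity) hd.ne']
  refine Real.log_le_log (by positivity) ?_
  rw [add_div, div_self hd.ne']
  have key : v * h / (2 * C) ≤ v * h / (2 * κ) / d := by
    rw [div_div]
    exact div_le_div_of_nonneg_left (mul_nonneg hv hh) (by positivity) (by nlinarith)
  linarith

/-- `log(|t| + A) − log t ≥ 0` for `t > 0`, `A ≥ 0`. [folklore] -/
theorem log_add_sub_log_nonneg {A t : ℝ} (hA : 0 ≤ A) (ht : 0 < t) : 0 ≤ Real.log (|t| + A) - Real.log t := by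
  rw [abs_of_pos ht, sub_nonneg]
  exact Real.log_le_log ht (by linarith)

/-- **THE BOX BOUND OF THE TIP RULE.**  On `[x₀,x₁] × [y₀,y₁]` let `F ≥ 0` be measurable with `F ≤ 1/(|e₁| + |e₂|)`; along every slice
`y ↦ e₁(x,y)` has derivative `≥ v` (or `≤ −v`), `y ↦ e₂(x,y)` has `|∂| ≤ m`, `|e₁| ≤ U₁`, and `|e₁(x,y)| + |e₂(x,y)| ≥ κ|x − x†|` (`v, κ > 0`,
`m ≥ 0`).  Then `F` is integrable on the box and `∫_box F ≤ (2(1 + m/v)/v)·h·(log(1 + 2U₁/(κh)) + 1)`, `h = x₁ − x₀` — the shape of the kernel's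
`Params.tipVariant` (`(v+m)/v² = (1+m/v)/v`, `Z₁/D ≥ 4U₁L/(J₀h)` with `κ = J₀/(2L)`). [folklore] -/
theorem tip_box_bound {F e₁ e₂ e₁y e₂y : ℝ → ℝ → ℝ} {x₀ x₁ y₀ y₁ v m κ U₁ xs : ℝ}
    (hx : x₀ < x₁) (hy : y₀ < y₁) (hv : 0 < v) (hm : 0 ≤ m) (hκ : 0 < κ)
    (hFm : Measurable (Function.uncurry F)) (hF0 : ∀ x y, 0 ≤ F x y)
    (hFle : ∀ x ∈ Icc x₀ x₁, ∀ y ∈ Icc y₀ y₁, F x y ≤ 1 / (|e₁ x y| + |e₂ x y|))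
    (he₁ : ∀ x y, HasDerivAt (fun t => e₁ x t) (e₁y x y) y)
    (hmono : (∀ x ∈ Icc x₀ x₁, ∀ y ∈ Icc y₀ y₁, v ≤ e₁y x y) ∨ (∀ x ∈ Icc x₀ x₁, ∀ y ∈ Icc y₀ y₁, e₁y x y ≤ -v))
    (he₂ : ∀ x y, HasDerivAt (fun t => e₂ x t) (e₂y x y) y) (hm' : ∀ x ∈ Icc x₀ x₁, ∀ y ∈ Icc y₀ y₁, |e₂y x y| ≤ m)
    (hlow : ∀ x ∈ Icc x₀ x₁, ∀ y ∈ Icc y₀ y₁, κ * |x - xs| ≤ |e₁ x y| + |e₂ x y|)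
    (hU : ∀ x ∈ Icc x₀ x₁, ∀ y ∈ Icc y₀ y₁, |e₁ x y| ≤ U₁) :
    IntegrableOn (Function.uncurry F) (Icc x₀ x₁ ×ˢ Icc y₀ y₁) volume ∧
      ∫ z in Icc x₀ x₁ ×ˢ Icc y₀ y₁, Function.uncurry F z ≤
        2 * (1 + m / v) / v * (x₁ - x₀) * (Real.log (1 + 2 * U₁ / (κ * (x₁ - x₀))) + 1) := by
  have hX : 0 < x₁ - x₀ := sub_pos.2 hx
  have hY : 0 < y₁ - y₀ := sub_pos.2 hy
  have hy' : y₀ ≤ y₁ := hy.le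
  set c₀ : ℝ := (1 + m / v) * (2 / v) with hc₀
  have hc₀nn : 0 ≤ c₀ := by positivity
  set A : ℝ := v * (y₁ - y₀) / (2 * κ) with hAdef
  have hA : 0 < A := by positivity
  -- Step 0: the variation of `e₁` along a slice is at least `v·h_y` and at most `2U₁`
  have hvU : v * (y₁ - y₀) ≤ 2 * U₁ := by
    have hx0 : x₀ ∈ Icc x₀ x₁ := left_mem_Icc.2 hx.le
    have h1 := abs_le.1 (hU x₀ hx0 y₀ (left_mem_Icc.2 hy'))
    have h2 := abs_le.1 (hU x₀ hx0 y₁ (right_mem_Icc.2 hy'))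
    rcases hmono with hmo | hmo
    · have hg := mul_sub_le_sub_on (he₁ x₀) (hmo x₀ hx0) (left_mem_Icc.2 hy') (right_mem_Icc.2 hy') hy'
      linarith
    · have hneg : ∀ y, HasDerivAt (fun t => -e₁ x₀ t) (-e₁y x₀ y) y := fun y => (he₁ x₀ y).neg
      have hg := mul_sub_le_sub_on hneg (v := v) (fun y hy => by linarith [hmo x₀ hx0 y hy])
        (left_mem_Icc.2 hy') (right_mem_Icc.2 hy') hy'
      linarith
  -- Step 1: the slice bound, for x ≠ x†
  have slice : ∀ x ∈ Icc x₀ x₁, x ≠ xs →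
      ∫⁻ y in Icc y₀ y₁, ENNReal.ofReal (F x y) ≤ ENNReal.ofReal (c₀ * (Real.log (|x - xs| + A) - Real.log |x - xs|)) := by
    intro x hxI hne
    have hd : 0 < |x - xs| := abs_pos.2 (sub_ne_zero.2 hne)
    obtain ⟨ys, hys, hgrow⟩ : ∃ ys ∈ Icc y₀ y₁, ∀ y ∈ Icc y₀ y₁, |e₁ x ys| + v * |y - ys| ≤ |e₁ x y| := by
      rcases hmono with hmo | hmo
      · exact exists_abs_ge_add_mul_on_of_ge (he₁ x) hv (hmo x hxI) hy'
      · exact exists_abs_ge_add_mul_on_of_le (he₁ x) hv (hmo x hxI) hy'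
    set C : ℝ := |e₁ x ys| + |e₂ x ys| with hCdef
    have hCκ : κ * |x - xs| ≤ C := hlow x hxI ys hys
    have hC : 0 < C := lt_of_lt_of_le (mul_pos hκ hd) hCκ
    have hpt : ∀ y ∈ Icc y₀ y₁, F x y ≤ (1 + m / v) / (v * |y - ys| + C) := by
      intro y hyI
      have h1 : |e₁ x ys| + v * |y - ys| ≤ |e₁ x y| := hgrow y hyI
      have h2 : |e₂ x ys| - m * |y - ys| ≤ |e₂ x y| := by
        have hl := abs_sub_le_mul_abs_on (he₂ x) (hm' x hxI) hys hyI
        have ht := abs_sub_abs_le_abs_sub (e₂ x ys) (e₂ x y)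
        rw [abs_sub_comm (e₂ x ys) (e₂ x y)] at ht
        linarith
      have hpos : 0 < v * |y - ys| + (|e₁ x ys| + |e₂ x ys|) := by
        have : 0 ≤ v * |y - ys| := mul_nonneg hv.le (abs_nonneg _)
        linarith
      exact (hFle x hxI y hyI).trans (tip_pointwise_shift hv hm (abs_nonneg _) h1 h2 hpos)
    have hΦcont : Continuous fun y : ℝ => (1 + m / v) / (v * |y - ys| + C) := by
      refine Continuous.div continuous_const (by fun_prop) fun y => ?_
      have : 0 ≤ v * |y - ys| := mul_nonneg hv.le (abs_nonneg _)
      linarith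
    have hΦint : IntegrableOn (fun y : ℝ => (1 + m / v) / (v * |y - ys| + C)) (Icc y₀ y₁) volume :=
      hΦcont.continuousOn.integrableOn_Icc
    have hΦnn : 0 ≤ᵐ[volume.restrict (Icc y₀ y₁)] fun y : ℝ => (1 + m / v) / (v * |y - ys| + C) :=
      ae_of_all _ fun y => div_nonneg (by positivity) (by have : 0 ≤ v * |y - ys| := mul_nonneg hv.le (abs_nonneg _); linarith)
    calc ∫⁻ y in Icc y₀ y₁, ENNReal.ofReal (F x y)
        ≤ ∫⁻ y in Icc y₀ y₁, ENNReal.ofReal ((1 + m / v) / (v * |y - ys| + C)) :=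
          setLIntegral_mono' measurableSet_Icc fun y hyI => ENNReal.ofReal_le_ofReal (hpt y hyI)
      _ = ENNReal.ofReal (∫ y in Icc y₀ y₁, (1 + m / v) / (v * |y - ys| + C)) := by
          rw [ofReal_integral_eq_lintegral_ofReal hΦint hΦnn]
      _ ≤ ENNReal.ofReal (c₀ * Real.log (1 + v * (y₁ - y₀) / (2 * C))) := by
          apply ENNReal.ofReal_le_ofReal
          rw [integral_Icc_eq_integral_Ioc, ← intervalIntegral.integral_of_le hy']
          have h := integral_slice_majorant_le (y₀ := y₀) hv hm hC hY.le ys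
          rw [show y₀ + (y₁ - y₀) = y₁ by ring] at h
          calc ∫ y in y₀..y₁, (1 + m / v) / (v * |y - ys| + C)
              ≤ (1 + m / v) * (2 / v * Real.log (1 + v * (y₁ - y₀) / (2 * C))) := h
            _ = c₀ * Real.log (1 + v * (y₁ - y₀) / (2 * C)) := by rw [hc₀]; ring
      _ ≤ ENNReal.ofReal (c₀ * (Real.log (|x - xs| + A) - Real.log |x - xs|)) := by
          apply ENNReal.ofReal_le_ofReal
          exact mul_le_mul_of_nonneg_left (log_slice_le_of_ge hv.le hY.le hκ hd hCκ) hc₀nn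
  -- Step 2: Tonelli
  have hGm : Measurable fun z : ℝ × ℝ => ENNReal.ofReal (Function.uncurry F z) := ENNReal.measurable_ofReal.comp hFm
  have hprod : (volume : Measure (ℝ × ℝ)).restrict (Icc x₀ x₁ ×ˢ Icc y₀ y₁) =
      ((volume : Measure ℝ).restrict (Icc x₀ x₁)).prod ((volume : Measure ℝ).restrict (Icc y₀ y₁)) := by
    rw [Measure.prod_restrict]; rfl
  have hψint : IntegrableOn (fun x : ℝ => c₀ * (Real.log (|x - xs| + A) - Real.log |x - xs|)) (Icc x₀ x₁) volume := by
    have h1 : IntervalIntegrable (fun x : ℝ => Real.log (|x - xs| + A) - Real.log |x - xs|) volume x₀ x₁ := by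
      have := (intervalIntegrable_log_add_sub_log hA (x₀ - xs) (x₁ - xs)).comp_sub_right xs
      simp only [sub_add_cancel, Real.log_abs] at this ⊢
      exact this
    have h2 := (intervalIntegrable_iff_integrableOn_Icc_of_le hx.le).1 h1
    exact h2.const_mul c₀
  have hψnn : 0 ≤ᵐ[volume.restrict (Icc x₀ x₁)] fun x : ℝ => c₀ * (Real.log (|x - xs| + A) - Real.log |x - xs|) := by
    have hne : ∀ᵐ x ∂(volume : Measure ℝ), x ≠ xs := by rw [ae_iff]; simp
    filter_upwards [ae_restrict_of_ae (μ := volume) (s := Icc x₀ x₁) hne] with x hxs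
    have hd : 0 < |x - xs| := abs_pos.2 (sub_ne_zero.2 hxs)
    have := log_add_sub_log_nonneg hA.le hd
    rw [Real.log_abs] at this ⊢
    exact mul_nonneg hc₀nn (by rw [abs_abs] at this; exact this)
  have hlin : ∫⁻ z in Icc x₀ x₁ ×ˢ Icc y₀ y₁, ENNReal.ofReal (Function.uncurry F z) ≤
      ENNReal.ofReal (c₀ * ((x₁ - x₀) * Real.log (1 + 2 * A / (x₁ - x₀)) + (x₁ - x₀))) := by
    rw [hprod, lintegral_prod _ hGm.aemeasurable]
    have hne : ∀ᵐ x ∂((volume : Measure ℝ).restrict (Icc x₀ x₁)), x ≠ xs := by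
      have : ∀ᵐ x ∂(volume : Measure ℝ), x ≠ xs := by rw [ae_iff]; simp
      exact ae_restrict_of_ae this
    calc ∫⁻ x in Icc x₀ x₁, ∫⁻ y in Icc y₀ y₁, ENNReal.ofReal (Function.uncurry F (x, y))
        ≤ ∫⁻ x in Icc x₀ x₁, ENNReal.ofReal (c₀ * (Real.log (|x - xs| + A) - Real.log |x - xs|)) := by
          refine lintegral_mono_ae ?_
          filter_upwards [ae_restrict_mem measurableSet_Icc, hne] with x hxI hxs
          exact slice x hxI hxs
      _ = ENNReal.ofReal (∫ x in Icc x₀ x₁, c₀ * (Real.log (|x - xs| + A) - Real.log |x - xs|)) := by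
          rw [ofReal_integral_eq_lintegral_ofReal hψint hψnn]
      _ ≤ ENNReal.ofReal (c₀ * ((x₁ - x₀) * Real.log (1 + 2 * A / (x₁ - x₀)) + (x₁ - x₀))) := by
          apply ENNReal.ofReal_le_ofReal
          rw [integral_Icc_eq_integral_Ioc, ← intervalIntegral.integral_of_le hx.le, intervalIntegral.integral_const_mul]
          refine mul_le_mul_of_nonneg_left ?_ hc₀nn
          have h := integral_log_one_add_div_abs_le (x₀ := x₀) hA hX xs
          rwa [show x₀ + (x₁ - x₀) = x₁ by ring] at h
  -- Step 3: integrability and the value of the integral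
  have hnn : 0 ≤ᵐ[volume.restrict (Icc x₀ x₁ ×ˢ Icc y₀ y₁)] Function.uncurry F := ae_of_all _ fun z => hF0 z.1 z.2
  have hfin : HasFiniteIntegral (Function.uncurry F) (volume.restrict (Icc x₀ x₁ ×ˢ Icc y₀ y₁)) := by
    rw [hasFiniteIntegral_iff_ofReal hnn]
    exact lt_of_le_of_lt hlin ENNReal.ofReal_lt_top
  have hint : IntegrableOn (Function.uncurry F) (Icc x₀ x₁ ×ˢ Icc y₀ y₁) volume := ⟨hFm.aestronglyMeasurable, hfin⟩
  refine ⟨hint, ?_⟩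
  have hB₀ : 0 ≤ c₀ * ((x₁ - x₀) * Real.log (1 + 2 * A / (x₁ - x₀)) + (x₁ - x₀)) := by
    have h2A : 0 ≤ 2 * A / (x₁ - x₀) := by positivity
    have : 0 ≤ Real.log (1 + 2 * A / (x₁ - x₀)) := Real.log_nonneg (by linarith)
    positivity
  rw [integral_eq_lintegral_of_nonneg_ae hnn hFm.aestronglyMeasurable]
  calc (∫⁻ z in Icc x₀ x₁ ×ˢ Icc y₀ y₁, ENNReal.ofReal (Function.uncurry F z)).toReal
      ≤ (ENNReal.ofReal (c₀ * ((x₁ - x₀) * Real.log (1 + 2 * A / (x₁ - x₀)) + (x₁ - x₀)))).toReal :=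
        ENNReal.toReal_mono ENNReal.ofReal_ne_top hlin
    _ = c₀ * ((x₁ - x₀) * Real.log (1 + 2 * A / (x₁ - x₀)) + (x₁ - x₀)) := ENNReal.toReal_ofReal hB₀
    _ ≤ 2 * (1 + m / v) / v * (x₁ - x₀) * (Real.log (1 + 2 * U₁ / (κ * (x₁ - x₀))) + 1) := by
        have hlog : Real.log (1 + 2 * A / (x₁ - x₀)) ≤ Real.log (1 + 2 * U₁ / (κ * (x₁ - x₀))) := by
          refine Real.log_le_log (by positivity) ?_
          have : 2 * A / (x₁ - x₀) ≤ 2 * U₁ / (κ * (x₁ - x₀)) := by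
            rw [hAdef, div_le_div_iff₀ hX (by positivity)]
            have e : 2 * (v * (y₁ - y₀) / (2 * κ)) * (κ * (x₁ - x₀)) = v * (y₁ - y₀) * (x₁ - x₀) := by
              field_simp
            rw [e]
            nlinarith
          linarith
        have e₀ : c₀ = 2 * (1 + m / v) / v := by rw [hc₀]; ring
        rw [e₀]
        have hk : 0 ≤ 2 * (1 + m / v) / v * (x₁ - x₀) := by positivity
        nlinarith [hlog, hk]

/-- **The box bound, transposed** (slices in `x`, outer integral in `y`): the same conclusion on the same box when `x ↦ e₁(x,y)` is the
monotone direction (speed `≥ v`), `x ↦ e₂(x,y)` is `m`-Lipschitz, and `|e₁| + |e₂| ≥ κ|y − y†|`; the bound carries `h = y₁ − y₀`. [folklore] -/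
theorem tip_box_bound_swap {F e₁ e₂ e₁x e₂x : ℝ → ℝ → ℝ} {x₀ x₁ y₀ y₁ v m κ U₁ ys : ℝ}
    (hx : x₀ < x₁) (hy : y₀ < y₁) (hv : 0 < v) (hm : 0 ≤ m) (hκ : 0 < κ)
    (hFm : Measurable (Function.uncurry F)) (hF0 : ∀ x y, 0 ≤ F x y)
    (hFle : ∀ x ∈ Icc x₀ x₁, ∀ y ∈ Icc y₀ y₁, F x y ≤ 1 / (|e₁ x y| + |e₂ x y|))
    (he₁ : ∀ x y, HasDerivAt (fun t => e₁ t y) (e₁x x y) x)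
    (hmono : (∀ x ∈ Icc x₀ x₁, ∀ y ∈ Icc y₀ y₁, v ≤ e₁x x y) ∨ (∀ x ∈ Icc x₀ x₁, ∀ y ∈ Icc y₀ y₁, e₁x x y ≤ -v))
    (he₂ : ∀ x y, HasDerivAt (fun t => e₂ t y) (e₂x x y) x) (hm' : ∀ x ∈ Icc x₀ x₁, ∀ y ∈ Icc y₀ y₁, |e₂x x y| ≤ m)
    (hlow : ∀ x ∈ Icc x₀ x₁, ∀ y ∈ Icc y₀ y₁, κ * |y - ys| ≤ |e₁ x y| + |e₂ x y|)
    (hU : ∀ x ∈ Icc x₀ x₁, ∀ y ∈ Icc y₀ y₁, |e₁ x y| ≤ U₁) :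
    IntegrableOn (Function.uncurry F) (Icc x₀ x₁ ×ˢ Icc y₀ y₁) volume ∧
      ∫ z in Icc x₀ x₁ ×ˢ Icc y₀ y₁, Function.uncurry F z ≤
        2 * (1 + m / v) / v * (y₁ - y₀) * (Real.log (1 + 2 * U₁ / (κ * (y₁ - y₀))) + 1) := by
  -- apply the box bound to the transposed functions
  have hT := tip_box_bound (F := fun y x => F x y) (e₁ := fun y x => e₁ x y) (e₂ := fun y x => e₂ x y)
    (e₁y := fun y x => e₁x x y) (e₂y := fun y x => e₂x x y) (xs := ys) hy hx hv hm hκ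
    (hFm.comp measurable_swap) (fun y x => hF0 x y) (fun y hy x hx => hFle x hx y hy) (fun y x => he₁ x y)
    (hmono.elim (fun h => Or.inl fun y hy x hx => h x hx y hy) (fun h => Or.inr fun y hy x hx => h x hx y hy))
    (fun y x => he₂ x y) (fun y hy x hx => hm' x hx y hy) (fun y hy x hx => hlow x hx y hy) (fun y hy x hx => hU x hx y hy)
  obtain ⟨hint, hle⟩ := hT
  have hsw : (Function.uncurry fun y x => F x y) = Function.uncurry F ∘ Prod.swap := by
    funext z; rfl
  rw [hsw] at hint hle
  have hint' : IntegrableOn (Function.uncurry F) (Icc x₀ x₁ ×ˢ Icc y₀ y₁) volume := by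
    have h := hint.swap
    have e : (Function.uncurry F ∘ Prod.swap) ∘ Prod.swap = Function.uncurry F := by funext z; rfl
    rw [e] at h
    exact h
  refine ⟨hint', ?_⟩
  have hval : ∫ z in Icc y₀ y₁ ×ˢ Icc x₀ x₁, (Function.uncurry F ∘ Prod.swap) z = ∫ z in Icc x₀ x₁ ×ˢ Icc y₀ y₁, Function.uncurry F z := by
    have := setIntegral_prod_swap (μ := (volume : Measure ℝ)) (ν := (volume : Measure ℝ)) (Icc x₀ x₁) (Icc y₀ y₁) (Function.uncurry F)
    exact this
  rw [← hval]
  exact hle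

end Summit.HubbardSuperconductivity.HubbardSuperconductivity.Theorems.KlLindhardEnclosure

end
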